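import Summits.MatrixMultiplication.MatrixMultiplication.Theses.FidelityWitnesses

/-!
# `FidelityWitnesses.LinearDefectLaw` (stmt-MatrixMultiplication-14039), line `border-singular-values` — I: fidelity vocabulary and the telescoping glue

First of three reduction files of the line lead's skeleton (`Cruxes/LinearDefectLaw/Lines/border_singular_values.lean`, reshape r2).
The line's vocabulary for `T = ⟨n,n,n⟩ = matMulTensor ℂ n n n` on `P n = Fin n × Fin n`: `overlap S = Σ S·T`, `normSq S = Σ‖S‖²`,
`fid S = |overlap S|²/normSq S` (`= ‖P_{ℂS}T‖²`), `resid S = T − P_{ℂS}T`, `triEval E x y z = Σ E·x·y·z`, `IsUnitVec`; the transfer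
`UnitSlope` ("below the border rank one more border multiplication buys one more full unit": a bound `c` on `|overlap|²/normSq` at rank
`r + 1` and `r < R̲(T)` give the bound `c − 1` at rank `r`); Cauchy–Schwarz `overlap_sq_le : |Σ S·T|² ≤ n³·Σ‖S‖²` (the law at every level
`r ≥ R̲`); and the glue `law_of_unitSlope : UnitSlope → (body of LinearDefectLaw)` — downward telescoping from the level `r = R̲`, with
`R̲(⟨n,n,n⟩)` never evaluated (card border-singular-values, ideator's proof). Plus the bookkeeping lemmas `exists_unitProduct` (the unit
product `e⊗e⊗e`: rank ≤ 1, overlap 1, norm 1) and `fid_le_of_gain`. Files II (`…UnitSlope`) and III (`…OfCore`) build on this one.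
-/

noncomputable section

namespace Summit.MatrixMultiplication.MatrixMultiplication.Theorems.LinearDefectLaw.Reduction

open scoped BigOperators ComplexConjugate
open Literature.Computability.AlgebraicComplexity
open Summit.MatrixMultiplication.MatrixMultiplication.Theses.FidelityWitnesses (LinearDefectLaw)
open Summit.MatrixMultiplication.MatrixMultiplication.Theorems

set_option linter.dupNamespace false

/-! ## Vocabulary (as in the ideator's `Ideator2Sketch.lean`) -/

/-- index type of one slot of `⟨n,n,n⟩` -/
abbrev P (n : ℕ) : Type := Fin n × Fin n

/-- bilinear overlap `Σ S·⟨n,n,n⟩` (the crux's numerator before `‖·‖²`; `= conj ⟨S,T⟩`, `T` real). -/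
def overlap {n : ℕ} (S : P n → P n → P n → ℂ) : ℂ :=
  ∑ a, ∑ b, ∑ c, S a b c * matMulTensor ℂ n n n a b c

/-- squared Frobenius norm `Σ ‖S_{abc}‖²`. -/
def normSq {n : ℕ} (S : P n → P n → P n → ℂ) : ℝ :=
  ∑ a, ∑ b, ∑ c, ‖S a b c‖ ^ 2

/-- fidelity numerator `|Σ S·T|² / Σ‖S‖²` (`= ‖P_{ℂS} T‖²`; junk value `0` at `S = 0`). -/
def fid {n : ℕ} (S : P n → P n → P n → ℂ) : ℝ :=
  ‖overlap S‖ ^ 2 / normSq S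

/-- residual of `T = ⟨n,n,n⟩` after orthogonal projection onto the complex line `ℂ·S`:
`E_S = T − (⟨S,T⟩/⟨S,S⟩)·S` (entrywise; `resid 0 = T`). -/
def resid {n : ℕ} (S : P n → P n → P n → ℂ) : P n → P n → P n → ℂ :=
  fun a b c => matMulTensor ℂ n n n a b c - (conj (overlap S) / (normSq S : ℂ)) * S a b c

/-- trilinear evaluation `E(x,y,z) = Σ E_{abc} x_a y_b z_c`; `sup |E(x,y,z)|` over unit `x, y, z` is the
spectral (injective) norm `‖E‖_σ`. -/
def triEval {n : ℕ} (E : P n → P n → P n → ℂ) (x y z : P n → ℂ) : ℂ :=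
  ∑ a, ∑ b, ∑ c, E a b c * x a * y b * z c

/-- unit vector in one slot -/
def IsUnitVec {n : ℕ} (x : P n → ℂ) : Prop := ∑ i, ‖x i‖ ^ 2 = 1

/-- **The Transfer `C⁺ = UnitSlope`** ("every border singular value of `⟨n,n,n⟩` is at least one"): below
the border rank, one more (border) multiplication buys at least one more full unit of overlap. `R̲` enters only
through the hypothesis `r < R̲`. Implies the crux (`law_of_unitSlope`, proved); implied by the three stubs
(`unitSlope_of_stubs`, proved). -/
def UnitSlope : Prop :=
  ∀ (n r : ℕ) (c : ℝ), r < algBorderRank (matMulTensor ℂ n n n) →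
    (∀ S' : P n → P n → P n → ℂ, tensorRank S' ≤ r + 1 → ‖overlap S'‖ ^ 2 ≤ c * normSq S') →
    ∀ S : P n → P n → P n → ℂ, tensorRank S ≤ r → ‖overlap S‖ ^ 2 ≤ (c - 1) * normSq S

/-! ## Elementary lemmas (proved) -/

/-- `0 ≤ normSq S`. -/
theorem normSq_nonneg {n : ℕ} (S : P n → P n → P n → ℂ) : 0 ≤ normSq S := by
  unfold normSq; positivity

/-- `normSq 0 = 0`. -/
theorem normSq_zero {n : ℕ} : normSq (0 : P n → P n → P n → ℂ) = 0 := by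
  simp [normSq]

/-- `overlap 0 = 0`. -/
theorem overlap_zero {n : ℕ} : overlap (0 : P n → P n → P n → ℂ) = 0 := by
  simp [overlap]

/-- `fid 0 = 0` (junk value of the quotient). -/
theorem fid_zero {n : ℕ} : fid (0 : P n → P n → P n → ℂ) = 0 := by
  simp [fid, overlap_zero]

/-- `0 ≤ fid S`. -/
theorem fid_nonneg {n : ℕ} (S : P n → P n → P n → ℂ) : 0 ≤ fid S := by
  unfold fid
  exact div_nonneg (by positivity) (normSq_nonneg S)

/-- `normSq S = 0 ↔ S = 0`. -/
theorem normSq_eq_zero_iff {n : ℕ} (S : P n → P n → P n → ℂ) : normSq S = 0 ↔ S = 0 := by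
  constructor
  · intro h
    funext a b c
    have ha := (Finset.sum_eq_zero_iff_of_nonneg (fun a _ => by positivity)).1 h a (Finset.mem_univ a)
    have hb := (Finset.sum_eq_zero_iff_of_nonneg (fun b _ => by positivity)).1 ha b (Finset.mem_univ b)
    have hc := (Finset.sum_eq_zero_iff_of_nonneg (fun c _ => by positivity)).1 hb c (Finset.mem_univ c)
    simpa using hc
  · rintro rfl
    exact normSq_zero

/-- a nonzero tensor has positive `normSq`. -/
theorem normSq_pos_of_ne_zero {n : ℕ} {S : P n → P n → P n → ℂ} (hS : S ≠ 0) : 0 < normSq S :=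
  (normSq_nonneg S).lt_of_ne' fun h => hS ((normSq_eq_zero_iff S).1 h)

/-- a nonzero tensor lives in a nonempty format -/
theorem pos_of_ne_zero {n : ℕ} {S : P n → P n → P n → ℂ} (hS : S ≠ 0) : 0 < n := by
  rcases Nat.eq_zero_or_pos n with h0 | h
  · subst h0
    exact absurd (funext fun a => a.1.elim0) hS
  · exact h

/-! ## Level `r ≥ R̲`: Cauchy–Schwarz, `|Σ S·T|² ≤ n³ · Σ‖S‖²` (ideator's proof) -/

/-- the entries of `⟨n,n,n⟩` over `ℂ` have norm equal to the real `0/1` entries. -/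
theorem norm_matMulTensor (n : ℕ) (a b c : P n) :
    ‖matMulTensor ℂ n n n a b c‖ = matMulTensor ℝ n n n a b c := by
  simp only [matMulTensor]
  split_ifs <;> simp

/-- the real entries of `⟨n,n,n⟩` are idempotent (`0/1`). -/
theorem sq_matMulTensor_real (n : ℕ) (a b c : P n) :
    matMulTensor ℝ n n n a b c ^ 2 = matMulTensor ℝ n n n a b c := by
  simp only [matMulTensor]
  split_ifs <;> simp

/-- `Σ_{abc} ⟨n,n,n⟩_{abc} = n³` (number of unit products). -/
theorem sum_matMulTensor_real (n : ℕ) :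
    (∑ a : P n, ∑ b : P n, ∑ c : P n, matMulTensor ℝ n n n a b c) = (n : ℝ) ^ 3 := by
  have h1 : ∀ a b : P n,
      (∑ c : P n, matMulTensor ℝ n n n a b c) = if a.1 = b.1 then 1 else 0 := by
    intro a b
    by_cases hab : a.1 = b.1
    · rw [if_pos hab, Finset.sum_eq_single (b.2, a.2)]
      · simp [matMulTensor, hab]
      · intro c _ hc
        simp only [matMulTensor]
        rw [if_neg]
        rintro ⟨-, h2, h3⟩
        exact hc (Prod.ext h2.symm h3.symm)
      · intro h
        exact absurd (Finset.mem_univ _) h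
    · rw [if_neg hab]
      exact Finset.sum_eq_zero fun c _ => by
        simp [matMulTensor, hab]
  have h2 : ∀ a : P n, (∑ b : P n, if a.1 = b.1 then (1 : ℝ) else 0) = n := by
    intro a
    rw [Fintype.sum_prod_type, Finset.sum_comm]
    simp
  simp_rw [h1, h2]
  simp [Finset.sum_const, Finset.card_univ, Fintype.card_prod, Fintype.card_fin]
  ring

/-- **Cauchy–Schwarz at `⟨n,n,n⟩`:** `|Σ S·T|² ≤ n³·Σ‖S‖²` for every `S` (the law at every level `r ≥ R̲`). -/
theorem overlap_sq_le {n : ℕ} (S : P n → P n → P n → ℂ) :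
    ‖overlap S‖ ^ 2 ≤ (n : ℝ) ^ 3 * normSq S := by
  let f : P n × P n × P n → ℝ := fun p => ‖S p.1 p.2.1 p.2.2‖
  let g : P n × P n × P n → ℝ := fun p => matMulTensor ℝ n n n p.1 p.2.1 p.2.2
  have hle : ‖overlap S‖ ≤ ∑ p, f p * g p := by
    have step : ‖overlap S‖ ≤ ∑ a, ∑ b, ∑ c, ‖S a b c‖ * matMulTensor ℝ n n n a b c := by
      unfold overlap
      refine (norm_sum_le _ _).trans (Finset.sum_le_sum fun a _ => ?_)
      refine (norm_sum_le _ _).trans (Finset.sum_le_sum fun b _ => ?_)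
      refine (norm_sum_le _ _).trans (Finset.sum_le_sum fun c _ => ?_)
      rw [norm_mul, norm_matMulTensor]
    simpa only [Fintype.sum_prod_type] using step
  have hf : (∑ p, f p ^ 2) = normSq S := by
    unfold normSq
    simp only [Fintype.sum_prod_type, f]
  have hg : (∑ p, g p ^ 2) = (n : ℝ) ^ 3 := by
    rw [← sum_matMulTensor_real n]
    simp only [Fintype.sum_prod_type, g, sq_matMulTensor_real]
  have hcs : (∑ p, f p * g p) ^ 2 ≤ (∑ p, f p ^ 2) * ∑ p, g p ^ 2 :=
    Finset.sum_mul_sq_le_sq_mul_sq _ _ _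
  rw [hf, hg] at hcs
  calc ‖overlap S‖ ^ 2 ≤ (∑ p, f p * g p) ^ 2 := pow_le_pow_left₀ (norm_nonneg _) hle 2
    _ ≤ normSq S * (n : ℝ) ^ 3 := hcs
    _ = (n : ℝ) ^ 3 * normSq S := mul_comm _ _

/-- fidelity is at most `n³` (junk-safe). -/
theorem fid_le_cube {n : ℕ} (S : P n → P n → P n → ℂ) : fid S ≤ (n : ℝ) ^ 3 := by
  unfold fid
  rcases (normSq_nonneg S).eq_or_lt with h0 | hpos
  · rw [← h0, div_zero]; positivity
  · rw [div_le_iff₀ hpos]; exact overlap_sq_le S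

/-! ## Glue `UnitSlope → LinearDefectLaw` (ideator's proof: telescoping downward from `r = R̲`) -/

/-- **`UnitSlope` implies the crux** (conclusion = the crux's body, so that only `linearDefectLaw_of_core` below
concludes the crux by name). -/
theorem law_of_unitSlope (h : UnitSlope) :
    ∀ n r : ℕ, ∀ S : Fin n × Fin n → Fin n × Fin n → Fin n × Fin n → ℂ, tensorRank S ≤ r →
      ‖∑ a, ∑ b, ∑ c, S a b c * matMulTensor ℂ n n n a b c‖ ^ 2 ≤
        ((n : ℝ) ^ 3 + (r : ℝ) - (algBorderRank (matMulTensor ℂ n n n) : ℝ)) *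
          ∑ a, ∑ b, ∑ c, ‖S a b c‖ ^ 2 := by
  intro n r S hS
  obtain ⟨b, hb⟩ : ∃ b : ℕ, algBorderRank (matMulTensor ℂ n n n) = b := ⟨_, rfl⟩
  have main : ∀ k r', r' + k = b → ∀ S₀ : P n → P n → P n → ℂ, tensorRank S₀ ≤ r' →
      ‖overlap S₀‖ ^ 2 ≤ ((n : ℝ) ^ 3 - k) * normSq S₀ := by
    intro k
    induction k with
    | zero =>
      intro r' _ S₀ _
      simpa using overlap_sq_le S₀
    | succ k ih =>
      intro r' hr' S₀ hS₀
      have hlt : r' < algBorderRank (matMulTensor ℂ n n n) := by rw [hb]; omega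
      have hyp : ∀ S' : P n → P n → P n → ℂ, tensorRank S' ≤ r' + 1 →
          ‖overlap S'‖ ^ 2 ≤ ((n : ℝ) ^ 3 - k) * normSq S' := ih (r' + 1) (by omega)
      have key := h n r' ((n : ℝ) ^ 3 - k) hlt hyp S₀ hS₀
      have e : (n : ℝ) ^ 3 - (k : ℝ) - 1 = (n : ℝ) ^ 3 - ((k + 1 : ℕ) : ℝ) := by
        push_cast; ring
      rw [e] at key
      exact key
  have goal : ‖overlap S‖ ^ 2 ≤ ((n : ℝ) ^ 3 + (r : ℝ) - (b : ℝ)) * normSq S := by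
    by_cases hrb : r ≤ b
    · obtain ⟨k, hk⟩ : ∃ k, r + k = b := ⟨b - r, by omega⟩
      have hcast : (n : ℝ) ^ 3 + (r : ℝ) - (b : ℝ) = (n : ℝ) ^ 3 - (k : ℝ) := by
        have : (b : ℝ) = (r : ℝ) + (k : ℝ) := by exact_mod_cast hk.symm
        rw [this]; ring
      rw [hcast]
      exact main k r hk S hS
    · have hbr : (b : ℝ) ≤ (r : ℝ) := by exact_mod_cast (Nat.lt_of_not_le hrb).le
      calc ‖overlap S‖ ^ 2 ≤ (n : ℝ) ^ 3 * normSq S := overlap_sq_le S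
        _ ≤ ((n : ℝ) ^ 3 + (r : ℝ) - (b : ℝ)) * normSq S := by
          apply mul_le_mul_of_nonneg_right _ (normSq_nonneg S)
          linarith
  rw [hb]
  simpa only [overlap, normSq] using goal

/-! ## Composition lemmas (proved): from the stubs to `UnitSlope` -/

/-- linearity of trilinear evaluation in the residual: `resid S (x,y,z) = T(x,y,z) − k·S(x,y,z)`. -/
theorem triEval_resid {n : ℕ} (S : P n → P n → P n → ℂ) (x y z : P n → ℂ) :
    triEval (resid S) x y z =
      triEval (matMulTensor ℂ n n n) x y z - (conj (overlap S) / (normSq S : ℂ)) * triEval S x y z := by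
  simp only [triEval, resid, sub_mul, Finset.sum_sub_distrib, Finset.mul_sum, mul_assoc]

/-- a standard unit product `e_a₀ ⊗ e_a₀ ⊗ e_a₀` (`a₀ = (0,0)`): rank `≤ 1`, overlap `1`, norm² `1`. -/
theorem exists_unitProduct {n : ℕ} (hn : 0 < n) :
    ∃ S₀ : P n → P n → P n → ℂ, tensorRank S₀ ≤ 1 ∧ overlap S₀ = 1 ∧ normSq S₀ = 1 := by
  let i : Fin n := ⟨0, hn⟩
  let e : P n → ℂ := Pi.single (i, i) 1
  have hval : ∀ a b c : P n, triad e e e a b c =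
      if c = (i, i) then (if b = (i, i) then (if a = (i, i) then 1 else 0) else 0) else 0 := by
    intro a b c
    by_cases ha : a = (i, i) <;> by_cases hb : b = (i, i) <;> by_cases hc : c = (i, i) <;>
      simp [e, ha, hb, hc]
  refine ⟨triad e e e, ?_, ?_, ?_⟩
  · exact tensorRank_le_of_eq_sum (fun _ : Fin 1 => e) (fun _ => e) (fun _ => e) (by simp)
  · have h : ∀ a b c : P n, triad e e e a b c * matMulTensor ℂ n n n a b c =
        if c = (i, i) then (if b = (i, i) then (if a = (i, i) then 1 else 0) else 0) else 0 := by
      intro a b c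
      rw [hval]
      by_cases ha : a = (i, i) <;> by_cases hb : b = (i, i) <;> by_cases hc : c = (i, i) <;>
        simp [matMulTensor, ha, hb, hc]
    unfold overlap
    simp_rw [h]
    simp only [Finset.sum_ite_eq', Finset.mem_univ, if_true]
  · have h : ∀ a b c : P n, ‖triad e e e a b c‖ ^ 2 =
        if c = (i, i) then (if b = (i, i) then (if a = (i, i) then (1 : ℝ) else 0) else 0) else 0 := by
      intro a b c
      rw [hval]
      by_cases ha : a = (i, i) <;> by_cases hb : b = (i, i) <;> by_cases hc : c = (i, i) <;>
        simp [ha, hb, hc]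
    unfold normSq
    simp_rw [h]
    simp only [Finset.sum_ite_eq', Finset.mem_univ, if_true]

/-- from a certified gain at rank `r + 1` to a bound at rank `r` (junk-safe in `fid`). -/
theorem fid_le_of_gain {n r : ℕ} {c : ℝ}
    (hc : ∀ S' : P n → P n → P n → ℂ, tensorRank S' ≤ r + 1 → ‖overlap S'‖ ^ 2 ≤ c * normSq S')
    {S S' : P n → P n → P n → ℂ} (hS' : tensorRank S' ≤ r + 1) {g : ℝ} (hg : 0 < g)
    (h : fid S + g ≤ fid S') : fid S ≤ c - g := by
  have key := hc S' hS'
  have h0S := fid_nonneg S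
  rcases (normSq_nonneg S').eq_or_lt with h0 | hpos
  · have hz : fid S' = 0 := by
      unfold fid
      rw [← h0, div_zero]
    linarith
  · have hle : fid S' ≤ c := by
      unfold fid
      rw [div_le_iff₀ hpos]
      exact key
    linarith

/-- **Registered glue stub `stub_lawOfUnitSlope`** (raw form of `law_of_unitSlope`): the unit slope implies the body of the crux. -/
theorem stub_lawOfUnitSlope :
    (∀ (n r : ℕ) (cst : ℝ), r < algBorderRank (matMulTensor ℂ n n n) → (∀ S' : Fin n × Fin n → Fin n × Fin n → Fin n × Fin n → ℂ, tensorRank S' ≤ r + 1 → ‖∑ a, ∑ b, ∑ c, S' a b c * matMulTensor ℂ n n n a b c‖ ^ 2 ≤ cst * ∑ a, ∑ b, ∑ c, ‖S' a b c‖ ^ 2) → ∀ S : Fin n × Fin n → Fin n × Fin n → Fin n × Fin n → ℂ, tensorRank S ≤ r → ‖∑ a, ∑ b, ∑ c, S a b c * matMulTensor ℂ n n n a b c‖ ^ 2 ≤ (cst - 1) * ∑ a, ∑ b, ∑ c, ‖S a b c‖ ^ 2) → ∀ n r : ℕ, ∀ S : Fin n × Fin n → Fin n × Fin n → Fin n ×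 Fin n → ℂ, tensorRank S ≤ r → ‖∑ a, ∑ b, ∑ c, S a b c * matMulTensor ℂ n n n a b c‖ ^ 2 ≤ ((n : ℝ) ^ 3 + (r : ℝ) - (algBorderRank (matMulTensor ℂ n n n) : ℝ)) * ∑ a, ∑ b, ∑ c, ‖S a b c‖ ^ 2 :=
  fun h => law_of_unitSlope h

end Summit.MatrixMultiplication.MatrixMultiplication.Theorems.LinearDefectLaw.Reduction

end
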